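import Literature.NumberTheory.EllipticCurves.ZpExtensionEisensteinPiTorsionCutInputsProofs
import Literature.NumberTheory.EllipticCurves.LocalKernelOfReductionDivisibleThreeProofs
import Literature.NumberTheory.EllipticCurves.TorsionFilAtCountMultiplicativeThreeProofs
import HarnessLib

/-!
# The F3 binders (hFsurj), (hbasis), (hTor-inst) for the curve's ordinary datum at a place `w ∣ 3` of MULTIPLICATIVE reduction
# (theorems only — no definition, no named fact, no instance, no `sorry`)

Topic `NumberTheory/EllipticCurves` (LEAD `bsd-wall-utd-p1`, crux r205 stmt-BirchSwinnertonDyer-24737 `TwinAlgMuZeroAtThree`,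
line `beta-road`, stub `stub_howardOutputsOfFamily`, E2 assembly at `v ∣ 3`).  §5 of x9/x10b's
`ZpExtensionEisensteinPiTorsionCutInputsProofs` (`ordinaryFiltrationAt_hFsurj`, `ordinaryFiltrationAt_hbasis`,
`piTorsionCut_hTor_ordinaryFiltrationAt`) at `p = 3` with (good reduction, ordinary point) replaced by multiplicative reduction
(`LocalKernelOfReductionDivisibleThreeProofs`, `TorsionFilAtCountMultiplicativeThreeProofs`); the generic §§1–4 are imported.
BSD is not proved by any of this.

References: [Howard2004HeegnerKolyvagin] §1.3 H.5(b), §3.1, Def. 3.2.5, Lemma 3.2.7; [GreenbergLNM1716] §2.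
-/

set_option autoImplicit false

noncomputable section

open Function NumberField IsDedekindDomain Field
open scoped NumberField ContRepresentation

namespace WeierstrassCurve

open Literature.NumberTheory.EllipticCurves Literature.NumberTheory.GaloisRepresentations
open Literature.NumberTheory.GaloisRepresentations.DiscreteGaloisModule
open Literature.NumberTheory.EllipticCurves.ZpExtension (EisensteinLevel OrdinaryFiltration)
open Literature.NumberTheory.GaloisCohomology.Howard2004
open Literature.NumberTheory.EllipticCurves.Tower

variable {K : Type} [Field K] [NumberField K] (E : WeierstrassCurve K) [E.IsElliptic]
  (κ : Literature.NumberTheory.EllipticCurves.ZpExtension K 3) {m : ℕ} (hm : 1 ≤ m) (w : HeightOneSpectrum (𝓞 K))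
  (Φ : OrdinaryFiltration (fun j ↦ E.torsionGaloisModule (((3 : ℕ) : ℤ) ^ j)) (fun j ↦ E.torsionGaloisModuleReduce 3 j) w)

variable {g₀ : absoluteGaloisGroup (w.adicCompletion K)} {s : ℕ}

/-! ## The binders of F3 discharged for the curve's ordinary datum `Φ := E.ordinaryFiltrationAt w` at a MULTIPLICATIVE `w ∣ 3` -/

/-- **(hFsurj) for `Φ := ordinaryFiltrationAt`**: `×p : Fil_w E[p^{k+1}] → Fil_w E[p^k]` is onto at a place `w ∋ p` of good
reduction with an ordinary point (tree `exists_mem_torsionFilAt_reduce_eq`, `Fil_w` being the kernel of reduction).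
[cite: GreenbergLNM1716, §2 p. 82] [cite: Howard2004HeegnerKolyvagin, Def. 3.2.5–3.2.6 (arXiv p. 16)] -/
theorem ordinaryFiltrationAt_hFsurj_of_hasMultiplicativeReductionAt_three (hpw : ((3 : ℕ) : 𝓞 K) ∈ w.asIdeal) (hmult : E.HasMultiplicativeReductionAt w)
    (k : ℕ) (y : geomTorsion E (((3 : ℕ) : ℤ) ^ k))
    (hy : y ∈ (E.ordinaryFiltrationAt w (fun j ↦ E.torsionGaloisModuleReduce 3 j) (fun _ _ ↦ rfl)).fil k) :
    ∃ y' ∈ (E.ordinaryFiltrationAt w (fun j ↦ E.torsionGaloisModuleReduce 3 j) (fun _ _ ↦ rfl)).fil (k + 1),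
      E.torsionGaloisModuleReduce 3 k y' = y :=
  E.exists_mem_torsionFilAt_reduce_eq_of_hasMultiplicativeReductionAt_three w hpw hmult (fun j ↦ E.torsionGaloisModuleReduce 3 j)
    (fun _ _ ↦ rfl) k y hy

/-- **(hbasis) for `Φ := ordinaryFiltrationAt`**: adapted bases of the `E[p^k]` (`Fil_w` a rank-one direct summand), `k ≥ 1`
(tree `exists_addEquiv_mem_torsionFilAt_iff`). [cite: Howard2004HeegnerKolyvagin, H.0 and §3.1 (arXiv p. 7 L57, p. 15 L56–62)]
[cite: GreenbergLNM1716, §2] -/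
theorem ordinaryFiltrationAt_hbasis_of_hasMultiplicativeReductionAt_three (hpw : ((3 : ℕ) : 𝓞 K) ∈ w.asIdeal) (hmult : E.HasMultiplicativeReductionAt w)
    (k : ℕ) (hk : 1 ≤ k) :
    ∃ e : geomTorsion E (((3 : ℕ) : ℤ) ^ k) ≃+ (Fin 2 → ZMod (3 ^ k)),
      ∀ x, x ∈ (E.ordinaryFiltrationAt w (fun j ↦ E.torsionGaloisModuleReduce 3 j) (fun _ _ ↦ rfl)).fil k ↔ e x 1 = 0 :=
  E.exists_addEquiv_mem_torsionFilAt_iff_of_hasMultiplicativeReductionAt_three w hpw hmult hk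

/-- **(hTor-inst) for the curve's ordinary datum `Φ := E.ordinaryFiltrationAt w`** at a place `w ∋ p` of good reduction with an
ordinary point: F2's first `H¹`-hypothesis with `r := 2p^s` (`κ(g₀) = p^s`, `2p^s < m`), the F3-binders `hFsurj`/`hbasis`
discharged by `ordinaryFiltrationAt_hFsurj`/`_hbasis`. [cite: Howard2004HeegnerKolyvagin, §1.3 H.5(b), §3.1, Def. 3.2.5 and Lemma 3.2.7 (arXiv p. 7 L96–97, p. 15–16)]
[cite: GreenbergLNM1716, §2 and proof of Prop. 4.15] -/
theorem piTorsionCut_hTor_ordinaryFiltrationAt_of_hasMultiplicativeReductionAt_three (hpw : ((3 : ℕ) : 𝓞 K) ∈ w.asIdeal) (hmult : E.HasMultiplicativeReductionAt w)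
    (hg₀ : (κ (absGaloisRestrict K (w.adicCompletion K) g₀)).toAdd = ((3 ^ s : ℕ) : ℤ_[3])) (hms : 2 * 3 ^ s < m)
    {q : ∀ a b, ((GaloisRep.toLocal w ((E.eisensteinPiRefinementDatum κ hm).levelRep a)).quotient
        (E.piFil κ hm (E.ordinaryFiltrationAt w (fun j ↦ E.torsionGaloisModuleReduce 3 j) (fun _ _ ↦ rfl)) a)
        (E.piFil_le_comap κ hm (E.ordinaryFiltrationAt w (fun j ↦ E.torsionGaloisModuleReduce 3 j) (fun _ _ ↦ rfl))
          a)).toContRepresentation →ⁱL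
      ((GaloisRep.toLocal w ((E.eisensteinPiRefinementDatum κ hm).levelRep b)).quotient
        (E.piFil κ hm (E.ordinaryFiltrationAt w (fun j ↦ E.torsionGaloisModuleReduce 3 j) (fun _ _ ↦ rfl)) b)
        (E.piFil_le_comap κ hm (E.ordinaryFiltrationAt w (fun j ↦ E.torsionGaloisModuleReduce 3 j) (fun _ _ ↦ rfl))
          b)).toContRepresentation}
    (hq : ∀ a b (x : (E.eisensteinPiRefinementDatum κ hm).Level a),
      q a b (Submodule.Quotient.mk x) = Submodule.Quotient.mk ((E.eisensteinPiRefinementDatum κ hm).map a b x))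
    {πq : ∀ j (n : ℕ), ((GaloisRep.toLocal w ((E.eisensteinPiRefinementDatum κ hm).levelRep j)).quotient
        (E.piFil κ hm (E.ordinaryFiltrationAt w (fun j ↦ E.torsionGaloisModuleReduce 3 j) (fun _ _ ↦ rfl)) j)
        (E.piFil_le_comap κ hm (E.ordinaryFiltrationAt w (fun j ↦ E.torsionGaloisModuleReduce 3 j) (fun _ _ ↦ rfl))
          j)).toContRepresentation →ⁱL
      ((GaloisRep.toLocal w ((E.eisensteinPiRefinementDatum κ hm).levelRep j)).quotient
        (E.piFil κ hm (E.ordinaryFiltrationAt w (fun j ↦ E.torsionGaloisModuleReduce 3 j) (fun _ _ ↦ rfl)) j)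
        (E.piFil_le_comap κ hm (E.ordinaryFiltrationAt w (fun j ↦ E.torsionGaloisModuleReduce 3 j) (fun _ _ ↦ rfl))
          j)).toContRepresentation}
    (hπq : ∀ j n (x : (E.eisensteinPiRefinementDatum κ hm).Level j),
      πq j n (Submodule.Quotient.mk x) = Submodule.Quotient.mk ((E.eisensteinPiRefinementDatum κ hm).π ^ n • x)) :
    ∀ w' ∈ compatibleFamilies
        (H := fun j ↦ galoisCohomology ((GaloisRep.toLocal w ((E.eisensteinPiRefinementDatum κ hm).levelRep j)).quotient
          (E.piFil κ hm (E.ordinaryFiltrationAt w (fun j ↦ E.torsionGaloisModuleReduce 3 j) (fun _ _ ↦ rfl)) j)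
          (E.piFil_le_comap κ hm (E.ordinaryFiltrationAt w (fun j ↦ E.torsionGaloisModuleReduce 3 j) (fun _ _ ↦ rfl))
            j)) 1)
        (fun j ↦ galoisCohomology.map (q (j + 1) j) 1),
      ∀ a : ℕ, (∀ j, 3 ^ a • w' j = 0) → ∀ j, galoisCohomology.map (πq j (2 * 3 ^ s)) 1 (w' j) = 0 :=
  E.piTorsionCut_hTor κ hm w (E.ordinaryFiltrationAt w (fun j ↦ E.torsionGaloisModuleReduce 3 j) (fun _ _ ↦ rfl))
    (E.ordinaryFiltrationAt_hFsurj_of_hasMultiplicativeReductionAt_three w hpw hmult)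
    (E.ordinaryFiltrationAt_hbasis_of_hasMultiplicativeReductionAt_three w hpw hmult) hg₀ hms hq hπq

end WeierstrassCurve

end
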